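import Summits.BirchSwinnertonDyer.BirchSwinnertonDyer.Theorems.ResidualThetaTransportAtTwoKatoZetaDefs
import Summits.BirchSwinnertonDyer.BirchSwinnertonDyer.Theorems.ThetaPartnerAtTwoSignedKatoUpToAtTwoPlusHondaWithLog
import Summits.BirchSwinnertonDyer.BirchSwinnertonDyer.Theorems.ThetaPartnerAtTwoSignedKatoUpToAtTwoLocalCyclotomicVariable
import Summits.BirchSwinnertonDyer.BirchSwinnertonDyer.Theorems.ThetaPartnerAtTwoSignedKatoUpToAtTwoKatoBKPairingCharSum
import Summits.BirchSwinnertonDyer.BirchSwinnertonDyer.Theorems.ThetaPartnerAtTwoSignedKatoUpToAtTwoPlusHondaLogPairingEnum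
import Summits.BirchSwinnertonDyer.BirchSwinnertonDyer.Theorems.ThetaPartnerAtTwoSignedKatoUpToAtTwoKatoBKSocketHelpers
import HarnessLib

/-!
# Station (R) of line `onepair` (crux RSL_g, stmt-BirchSwinnertonDyer-22608) — file R2: KOBAYASHI'S DICTIONARY PER `Θ`-COORDINATE
# (the character sums of the pinned layer pairings of `(C y)•z` along the displayed plus Honda datum, from (BKρ))

Route `ResidualThetaTransportAtTwo` (RTT), crux `ResidualSignedLambdaLowerCMAtTwo` (stmt-BirchSwinnertonDyer-22608), line `onepair` v3f, station (R)
`stub_kzgValueRelation`. Seat `bsd-wall-tp2-p2x-w3` g18 (width seat; helper, `--supports … --as helper`, closes nothing). THEOREMS ONLY (no definition,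
no instance, no notation, no `sorry`). BSD is not proved by anything here; 22608 / 26074 / 24105 OPEN / HOLD.

WHAT (memo `STATION-R-PORT-w3g18.md`, evidence #54 on 22608, step A of the port; TP2 precedent
`KatoZetaErlKSideCMAtTwo.katoZetaErlKSideCMAtTwoSupply_of_katoValuesKSide`, `A ↦ W`, `ℤ₂ ↦ 𝒪`, one coordinate `i` at a time):
* §1 `exists_plusHondaDatum_of_frame` — the DISPLAYED plus Honda datum at a place `v ∋ 2` for a GIVEN `2`-adic frame `(Φ, φ)` (the (R) stub quantifies
  over all frames `F : π.KatoFrame`, and (BKρ) speaks through `F.Φ`): `SignedEC.PlusLayer.plusHondaSystemTwo_padic_withLog` at `ι := Φ⁻¹ ∘ closureEmb`,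
  transported by `Φ` (verbatim the transport of `plusHondaSystemTwo_adicCompletion_withLog`, which displays its own frame instead).
* §2 `sum_pow_mul_pair_single_eq` — for the pins `π`, a frame `F`, a class `z` with (BKρ) `π.KatoBKCoord F.Φ F.τ z c′ w`, the displayed datum
  `(c, σ, d₀, d = Φ_* d₀)` and local variable `(g₀, g)`: for every layer `m`, every `y ∈ 𝒪`, every coordinate `i` and every EVEN PRIMITIVE `ψ` mod `2^{m+2}`,
  `Σ_{j<2^m} ψ(5)^j · ⟨proj_m((C y)•z), (g^j d_m)·e_i⟩_m = 3 · g(ψ) · Σ_l t₀(c′_i · y · bO_l) · Σ_b ψ̄(b) τ_b • w_{m+2,l}` in `ℚ̄₂`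
  ((BKρ) at the formal points `g₀^j d₀,m`; Kobayashi Prop. 8.25 `KatoBK.sum_pow_mul_trace_eq_mul` per `l`; the log character sum
  `LocalVar.sum_pow_mul_ptLogΩ_pow_smul_plusHondaPoint_eq` `= 3 g(ψ)`, level-free — finding F1/T85).
These are the coordinate VALUES consumed by R3a/R3b (`StationR.sum_mul_values_eq_of_equivariant`, `…tsum_apply_smul_eq_mul_tsum_of_equivariant`).

References: [Kato2004Asterisque] Thm. 12.5 (1) (pp. 221–222), §14.9 (p. 239); [BlochKato1990] §3 (3.10.1), (3.11); [Kobayashi2003] (8.23) (p. 18),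
Prop. 8.25–8.26 and proof of Thm. 6.3 (pp. 24–25).
-/

set_option autoImplicit false
-- D-0017: single-problem summit, so `Summit.BirchSwinnertonDyer.BirchSwinnertonDyer.…` repeats a namespace BY DESIGN.
set_option linter.dupNamespace false
set_option backward.isDefEq.respectTransparency false

noncomputable section

open scoped Classical NumberField

open NumberField IsDedekindDomain WeierstrassCurve Field Literature.NumberTheory.EllipticCurves
  Literature.NumberTheory.GaloisRepresentations Literature.NumberTheory.EllipticCurves.GreenbergSelmer
  Literature.NumberTheory.EllipticCurves.Rank1Residual Literature.NumberTheory.EllipticCurves.Kobayashi2003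
  Literature.NumberTheory.EllipticCurves.FormalGroupChart Literature.NumberTheory.EllipticCurves.ZpExtension
  Literature.NumberTheory.EllipticCurves.Sprung2012
  Summit.BirchSwinnertonDyer.Rank1Residual.Additive Summit.BirchSwinnertonDyer.Rank1Residual.Additive.PadicCyclotomicTower
  Summit.BirchSwinnertonDyer.Rank1Residual.Additive.BallEval Summit.BirchSwinnertonDyer.Rank1Residual.Additive.LocalTransport
  Summit.BirchSwinnertonDyer.BirchSwinnertonDyer.Theorems.SignedKatoOffTwo
  Summit.BirchSwinnertonDyer.BirchSwinnertonDyer.Theorems.SignedKatoOffTwo.LocalTwo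
  Summit.BirchSwinnertonDyer.BirchSwinnertonDyer.Theorems.SignedKatoOffTwo.KatoBK
  Summit.BirchSwinnertonDyer.BirchSwinnertonDyer.Theorems.OnePair
  Rat.HeightOneSpectrum

namespace Summit.BirchSwinnertonDyer.BirchSwinnertonDyer.Theorems.ThetaTransport.StationR

/-! ## §1 The displayed plus Honda datum for a GIVEN frame -/

set_option maxHeartbeats 400000 in
/-- **HONDA⁺@2 displayed at `v ∋ 2` THROUGH A GIVEN FRAME `(Φ, φ)`.** For `W/ℚ` globally minimal with `GoodSS W 2`, `a₂(W) = 0`, the cyclotomic `κ`,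
`v ∋ 2` and ANY frame `Φ : ℚ̄₂ ≃ ℚ̄_v` over `φ : ℚ₂ ≃ ℚ_v`: with `ι := Φ⁻¹ ∘ closureEmb` (so `closureEmb = Φ ∘ ι`) there are tower points `c_m`
(coordinates in `ℚ₂(ζ_{2^m})`, in `E₁`, `Λ(c_m) = ℓ_m`, fixed by `Stab ζ_{2^m}`), inverters `σ_m`, the plus Honda system `d₀` on the `2`-adic model and its
transport `d = Φ_* d₀` with (L), (TR), (GEN), (GEN₀). (= `plusHondaSystemTwo_adicCompletion_withLog` with the frame as INPUT.)
[cite: Kobayashi2003, Def. 1.1, §8.4 (Lemma 8.9, Props. 8.7, 8.11, 8.12)] [cite: Sprung2012, Thm. 2.2 (2′) (p. 1487)] -/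
theorem exists_plusHondaDatum_of_frame (W : WeierstrassCurve ℚ) [W.IsElliptic] [W.IsGloballyMinimal]
    (hss : GoodSS W 2) (ha : W.frobeniusTrace 2 = 0) (κ : ZpExtension ℚ 2) (hκ : κ.IsCyclotomic)
    (v : HeightOneSpectrum (𝓞 ℚ)) (hv : (2 : 𝓞 ℚ) ∈ v.asIdeal)
    (Φ : AlgebraicClosure ℚ_[2] ≃ₐ[ℚ] AlgebraicClosure (v.adicCompletion ℚ)) (φ : ℚ_[2] ≃+* v.adicCompletion ℚ)
    (hΦφ : ∀ y : ℚ_[2], Φ (algebraMap ℚ_[2] (AlgebraicClosure ℚ_[2]) y) = algebraMap (v.adicCompletion ℚ) (AlgebraicClosure (v.adicCompletion ℚ)) (φ y)) :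
    ∃ (ι : AlgebraicClosure ℚ →ₐ[ℚ] AlgebraicClosure ℚ_[2]) (_ : ∀ z, closureEmb (K := ℚ) (v.adicCompletion ℚ) z = Φ (ι z))
      (c : ℕ → localPoints W ℚ_[2]) (σ : ℕ → Field.absoluteGaloisGroup ℚ_[2]) (d₀ : ℕ → localPoints W ℚ_[2])
      (d : ℕ → localPoints W (v.adicCompletion ℚ)),
      (haveI := isIntegral_genFib_baseChange 2 ((integralModelInt W).map (Int.castRingHom ℤ_[2]))
        ∀ m, (toLoc ((genFibΩ_eq_baseChange ((integralModelInt W).map (Int.castRingHom ℤ_[2]))).trans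
              (baseChange_twoAdicModel W))).symm (c m) ∈
            subfieldPoints (genFibΩ 2 ((integralModelInt W).map (Int.castRingHom ℤ_[2]))) (layer 2 m).toSubfield
              coeffs_mem_layer ∧
          (toLoc ((genFibΩ_eq_baseChange ((integralModelInt W).map (Int.castRingHom ℤ_[2]))).trans
              (baseChange_twoAdicModel W))).symm (c m) ∈
            kernel (Valued.v (R := PadicAlgCl 2)) (genFibΩ 2 ((integralModelInt W).map (Int.castRingHom ℤ_[2]))) ∧
          ptLogΩ 2 ((integralModelInt W).map (Int.castRingHom ℤ_[2]))
            ((toLoc ((genFibΩ_eq_baseChange ((integralModelInt W).map (Int.castRingHom ℤ_[2]))).trans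
              (baseChange_twoAdicModel W))).symm (c m)) = ell 2 m) ∧
      (∀ m, ∀ τ ∈ stab 2 m, τ • c m = c m) ∧
      (∀ m, 1 ≤ m → σ m • zeta 2 m = (zeta 2 m)⁻¹) ∧
      (∀ n, d₀ n = 3 • (c (n + 2) + σ (n + 2) • c (n + 2)) - 2 • c 1) ∧
      (∀ m, d₀ m ∈ localLayerPointsOfEmb κ ι W m) ∧
      (∀ m, d m = WeierstrassCurve.Affine.Point.map (W' := W)
        (Φ : AlgebraicClosure ℚ_[2] →ₐ[ℚ] AlgebraicClosure (v.adicCompletion ℚ))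
        (show (W.baseChange (AlgebraicClosure ℚ_[2])).toAffine.Point from d₀ m)) ∧
      (∀ m, d m ∈ localLayerPointsOfEmb κ (closureEmb (K := ℚ) (v.adicCompletion ℚ)) W m) ∧
      (∀ m, localTraceOfEmb κ (closureEmb (K := ℚ) (v.adicCompletion ℚ)) W (m + 1) (m + 2) (d (m + 2)) = -d m) ∧
      (∀ m : ℕ, 1 ≤ m → ∀ P ∈ localLayerPointsOfEmb κ (closureEmb (K := ℚ) (v.adicCompletion ℚ)) W m,
        ∃ B ∈ AddSubgroup.closure (Set.range fun τ : Field.absoluteGaloisGroup (v.adicCompletion ℚ) ↦ τ • d m),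
          ∃ P' ∈ localLayerPointsOfEmb κ (closureEmb (K := ℚ) (v.adicCompletion ℚ)) W (m - 1),
          ∃ R ∈ localLayerPointsOfEmb κ (closureEmb (K := ℚ) (v.adicCompletion ℚ)) W m, P = B + P' + 2 • R) ∧
      (∀ P ∈ localLayerPointsOfEmb κ (closureEmb (K := ℚ) (v.adicCompletion ℚ)) W 0,
        ∃ a : ℤ, ∃ R ∈ localLayerPointsOfEmb κ (closureEmb (K := ℚ) (v.adicCompletion ℚ)) W 0, P = a • d 0 + 2 • R) := by
  -- the embedding `ι := Φ⁻¹ ∘ closureEmb`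
  set ι : AlgebraicClosure ℚ →ₐ[ℚ] AlgebraicClosure ℚ_[2] :=
    (Φ.symm : AlgebraicClosure (v.adicCompletion ℚ) →ₐ[ℚ] AlgebraicClosure ℚ_[2]).comp (closureEmb (K := ℚ) (v.adicCompletion ℚ)) with hιdef
  have hcompat : ∀ z, closureEmb (K := ℚ) (v.adicCompletion ℚ) z = Φ (ι z) := by
    intro z
    simp only [hιdef, AlgHom.comp_apply, AlgEquiv.coe_toAlgHom, AlgEquiv.apply_symm_apply]
  obtain ⟨c, σ, d₀, hcΩ, hcstab, hσ, hd, hL, hTR, hGEN, hND⟩ :=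
    SignedEC.PlusLayer.plusHondaSystemTwo_padic_withLog W hss ha κ hκ ι
  let T : localPoints W ℚ_[2] →+ localPoints W (v.adicCompletion ℚ) :=
    WeierstrassCurve.Affine.Point.map (W' := W) (Φ : AlgebraicClosure ℚ_[2] →ₐ[ℚ] AlgebraicClosure (v.adicCompletion ℚ))
  have hT : ∀ P : localPoints W ℚ_[2], T P =
      WeierstrassCurve.Affine.Point.map (W' := W) (Φ : AlgebraicClosure ℚ_[2] →ₐ[ℚ] AlgebraicClosure (v.adicCompletion ℚ))
        (show (W.baseChange (AlgebraicClosure ℚ_[2])).toAffine.Point from P) := fun _ ↦ rfl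
  have hmem := SignedEC.modelMap_mem_localLayerPointsOfEmb_iff Φ φ hΦφ ι (closureEmb (K := ℚ) (v.adicCompletion ℚ)) hcompat W T hT κ
  have hL' : ∀ m, T (d₀ m) ∈ localLayerPointsOfEmb κ (closureEmb (K := ℚ) (v.adicCompletion ℚ)) W m :=
    fun m ↦ (hmem m _).mpr (hL m)
  have hTR' : ∀ m, localTraceOfEmb κ (closureEmb (K := ℚ) (v.adicCompletion ℚ)) W (m + 1) (m + 2) (T (d₀ (m + 2))) = -T (d₀ m) := by
    intro m
    rw [← SignedEC.modelMap_localTraceOfEmb Φ φ hΦφ ι (closureEmb (K := ℚ) (v.adicCompletion ℚ)) hcompat W T hT κ (m + 1) (m + 2)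
      (hL (m + 2)), hTR, map_neg]
  have hGEN' : ∀ m : ℕ, 1 ≤ m → ∀ P ∈ localLayerPointsOfEmb κ (closureEmb (K := ℚ) (v.adicCompletion ℚ)) W m,
      ∃ B ∈ AddSubgroup.closure (Set.range fun τ : Field.absoluteGaloisGroup (v.adicCompletion ℚ) ↦ τ • T (d₀ m)),
        ∃ P' ∈ localLayerPointsOfEmb κ (closureEmb (K := ℚ) (v.adicCompletion ℚ)) W (m - 1),
        ∃ R ∈ localLayerPointsOfEmb κ (closureEmb (K := ℚ) (v.adicCompletion ℚ)) W m, P = B + P' + 2 • R := by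
    intro m hm P' hP'
    obtain ⟨P, rfl⟩ := SignedEC.modelMap_surjective Φ W T hT P'
    obtain ⟨B, hB, P₁, hP₁, R, hR, hPe⟩ := hGEN m hm P ((hmem m P).mp hP')
    refine ⟨T B, ?_, T P₁, (hmem _ _).mpr hP₁, T R, (hmem _ _).mpr hR, by rw [hPe, map_add, map_add, map_nsmul]⟩
    rw [← SignedEC.map_modelMap_closure_orbit Φ φ hΦφ W T hT]
    exact AddSubgroup.mem_map_of_mem T hB
  have hND' : ∀ b ∈ localLayerPointsOfEmb κ (closureEmb (K := ℚ) (v.adicCompletion ℚ)) W 0, T (d₀ 0) ≠ 2 • b :=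
    SignedEC.nonDiv_modelTransport Φ φ hΦφ ι (closureEmb (K := ℚ) (v.adicCompletion ℚ)) hcompat W T hT κ 2 hND
  have hGEN0' := SignedEC.plusGenZero_two_of_ne_two_nsmul W hss κ v hv _ (hL' 0) hND'
  exact ⟨ι, hcompat, c, σ, d₀, fun m ↦ T (d₀ m), hcΩ, hcstab, hσ, hd, hL, fun _ ↦ rfl, hL', hTR', hGEN', hGEN0'⟩

/-! ## §2 The dictionary: character sums of the pinned pairings of `(C y)•z` against the orbit of the plus Honda point -/

section Dictionary

variable {S : Set (PadicAlgCl 2)} {W : WeierstrassCurve ℚ} [W.IsElliptic] [W.IsGloballyMinimal] {κ : ZpExtension ℚ 2} {γ : absoluteGaloisGroup ℚ}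
  {S₀ : Finset (HeightOneSpectrum (𝓞 ℚ))} {n : ℕ} {ρ : FramedGaloisRep ℚ ↥(padicCoeffIntegers S) 2}
  {Θ : ∀ v : HeightOneSpectrum (𝓞 ℚ), ((2 : ℕ) : 𝓞 ℚ) ∈ v.asIdeal → (Cofree ρ ↥(padicCoeffField S) ≃+ (Fin n → ↥(W.geomPrimaryTorsion 2)))}
  {hΘ : ∀ v hv (δ : absoluteGaloisGroup (v.adicCompletion ℚ)) m i,
    Θ v hv (resGalOfEmb (closureEmb (K := ℚ) (v.adicCompletion ℚ)) δ • m) i = resGalOfEmb (closureEmb (K := ℚ) (v.adicCompletion ℚ)) δ • Θ v hv m i}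
  {I : Kato2004.IwasawaH1DataCoeff (FramedGaloisRep.toGaloisRep ρ) 2 κ γ}
  {Sg : AddSubgroup (subgroupH1 κ.kerSubgroup (Cofree ρ ↥(padicCoeffField S)))} [Module ↥(padicCoeffIntegers S) ↥Sg]

set_option maxHeartbeats 1600000 in
/-- **Kobayashi's dictionary per `Θ`-coordinate (step A of the (R) port).** Pins `π`, frame `F`, a class `z ∈ 𝐇¹` with (BKρ)
`π.KatoBKCoord F.Φ F.τ z c′ w`; the displayed plus Honda datum through `F.Φ` (`c`, `σ`, `d₀`, `d = Φ_* d₀`, from `exists_plusHondaDatum_of_frame`) and the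
displayed local variable (`g₀`, `g`, from `LocalVar.exists_localVariable_two`). Then for every layer `m`, `y ∈ 𝒪`, coordinate `i`, and every EVEN
PRIMITIVE Dirichlet character `ψ` mod `2^{m+2}` with values in `ℚ̄₂`:
`Σ_{j<2^m} ψ(5)^j · ⟨proj_m((C y)•z), (g^j • d_m)·e_i⟩_m = 3 · g(ψ) · Σ_l t₀(c′_i · y · bO_l) · Σ_{b ∈ (ℤ/2^{m+2})ˣ} ψ̄(b) · τ_b • w_{m+2,l}`.
((BKρ) at the formal points `g₀^j • d₀,m`; per `l` the factorisation `KatoBK.sum_pow_mul_trace_eq_mul` (Kobayashi Prop. 8.25) and the log character sum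
`LocalVar.sum_pow_mul_ptLogΩ_pow_smul_plusHondaPoint_eq` `= 3·g(ψ)`.) [cite: Kato2004Asterisque, Thm. 12.5 (1) (pp. 221–222)]
[cite: BlochKato1990, §3 (3.10.1), (3.11)] [cite: Kobayashi2003, (8.23) (p. 18), Prop. 8.25–8.26 (pp. 24–25)] -/
theorem sum_pow_mul_pair_single_eq (hκ : κ.IsCyclotomic) (π : OnePairPins S W κ γ S₀ n ρ Θ hΘ I Sg) (F : π.KatoFrame)
    (ι : AlgebraicClosure ℚ →ₐ[ℚ] AlgebraicClosure ℚ_[2])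
    (z : I.H) (c' : Fin n → ↥(padicCoeffIntegers S)) (w : ℕ → Fin π.nb → PadicAlgCl 2) (hBK : π.KatoBKCoord F.Φ F.τ z c' w)
    -- the displayed plus Honda datum through `F.Φ`
    {cc : ℕ → localPoints W ℚ_[2]} {σσ : ℕ → Field.absoluteGaloisGroup ℚ_[2]} {d₀ : ℕ → localPoints W ℚ_[2]}
    {d : ℕ → localPoints W (π.v.adicCompletion ℚ)}
    (hcΩ : haveI := isIntegral_genFib_baseChange 2 ((integralModelInt W).map (Int.castRingHom ℤ_[2]))
        ∀ m, (toLoc ((genFibΩ_eq_baseChange ((integralModelInt W).map (Int.castRingHom ℤ_[2]))).trans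
              (baseChange_twoAdicModel W))).symm (cc m) ∈
            subfieldPoints (genFibΩ 2 ((integralModelInt W).map (Int.castRingHom ℤ_[2]))) (layer 2 m).toSubfield
              coeffs_mem_layer ∧
          (toLoc ((genFibΩ_eq_baseChange ((integralModelInt W).map (Int.castRingHom ℤ_[2]))).trans
              (baseChange_twoAdicModel W))).symm (cc m) ∈
            kernel (Valued.v (R := PadicAlgCl 2)) (genFibΩ 2 ((integralModelInt W).map (Int.castRingHom ℤ_[2]))) ∧
          ptLogΩ 2 ((integralModelInt W).map (Int.castRingHom ℤ_[2]))
            ((toLoc ((genFibΩ_eq_baseChange ((integralModelInt W).map (Int.castRingHom ℤ_[2]))).trans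
              (baseChange_twoAdicModel W))).symm (cc m)) = ell 2 m)
    (hcstab : ∀ m, ∀ τ ∈ stab 2 m, τ • cc m = cc m)
    (hσσ : ∀ m, 1 ≤ m → σσ m • zeta 2 m = (zeta 2 m)⁻¹)
    (hd₀ : ∀ k, d₀ k = 3 • (cc (k + 2) + σσ (k + 2) • cc (k + 2)) - 2 • cc 1)
    (hd₀L : ∀ m, d₀ m ∈ localLayerPointsOfEmb κ ι W m)
    (hdT : ∀ m, d m = WeierstrassCurve.Affine.Point.map (W' := W)
      (F.Φ : AlgebraicClosure ℚ_[2] →ₐ[ℚ] AlgebraicClosure (π.v.adicCompletion ℚ))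
      (show (W.baseChange (AlgebraicClosure ℚ_[2])).toAffine.Point from d₀ m))
    (hdL : ∀ m, d m ∈ localLayerPointsOfEmb κ (closureEmb (K := ℚ) (π.v.adicCompletion ℚ)) W m)
    -- the displayed local variable
    {g₀ : Field.absoluteGaloisGroup ℚ_[2]} {g : Field.absoluteGaloisGroup (π.v.adicCompletion ℚ)}
    (hζpow : ∀ m j : ℕ, g₀ ^ j • zeta 2 m = zeta 2 m ^ 5 ^ j)
    (hTg : ∀ (W' : WeierstrassCurve ℚ) (j : ℕ) (P : localPoints W' ℚ_[2]),
      (show localPoints W' (π.v.adicCompletion ℚ) from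
        WeierstrassCurve.Affine.Point.map (W' := W')
          (F.Φ : AlgebraicClosure ℚ_[2] →ₐ[ℚ] AlgebraicClosure (π.v.adicCompletion ℚ))
          (show (W'.baseChange (AlgebraicClosure ℚ_[2])).toAffine.Point from (g₀ ^ j • P))) =
        g ^ j • (show localPoints W' (π.v.adicCompletion ℚ) from
          WeierstrassCurve.Affine.Point.map (W' := W')
            (F.Φ : AlgebraicClosure ℚ_[2] →ₐ[ℚ] AlgebraicClosure (π.v.adicCompletion ℚ))
            (show (W'.baseChange (AlgebraicClosure ℚ_[2])).toAffine.Point from P)))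
    (m : ℕ) (y : ↥(padicCoeffIntegers S)) (i : Fin n)
    (ψ : DirichletCharacter (PadicAlgCl 2) (2 ^ (m + 2))) (hψev : ψ (-1) = 1) (hψprim : ψ.IsPrimitive) :
    haveI : NeZero (2 ^ (m + 2)) := ⟨pow_ne_zero _ two_ne_zero⟩
    ∑ j ∈ Finset.range (2 ^ m), ψ (5 : ZMod (2 ^ (m + 2))) ^ j *
        algebraMap ℚ_[2] (PadicAlgCl 2)
          ((π.pair m (I.proj m ((PowerSeries.C y : IwasawaAlgebraO S) • z))
            (Pi.single i ⟨g ^ j • d m, smul_mem_localLayerPointsOfEmb κ (closureEmb (K := ℚ) (π.v.adicCompletion ℚ)) W m (g ^ j) (hdL m)⟩) :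
              ℤ_[2]) : ℚ_[2]) =
      3 * gaussSum ψ (AddChar.zmodChar (2 ^ (m + 2)) (HondaLog.zeta_pow_prime_pow_self (p := 2) (m + 2))) *
        ∑ l : Fin π.nb, algebraMap ℚ_[2] (PadicAlgCl 2) ((π.t₀ (c' i * y * π.bO l) : ℤ_[2]) : ℚ_[2]) *
          ∑ b : (ZMod (2 ^ (m + 2)))ˣ, ψ⁻¹ (b : ZMod (2 ^ (m + 2))) * F.τ (m + 2) (b : ZMod (2 ^ (m + 2))) • w (m + 2) l := by
  haveI : NeZero (2 ^ (m + 2)) := ⟨pow_ne_zero _ two_ne_zero⟩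
  haveI : NeZero (2 ^ m) := ⟨pow_ne_zero _ two_ne_zero⟩
  haveI hintΩ := isIntegral_genFib_baseChange 2 ((integralModelInt W).map (Int.castRingHom ℤ_[2]))
  -- the orbit of logarithms of the displayed plus Honda point `d₀ m`
  have hk0 := @toLoc_symm_plusPoint_mem_kernel W _ cc σσ d₀ (fun k ↦ (hcΩ k).2.1) hd₀ m
  obtain ⟨L, hLdef⟩ : ∃ L : ℕ → PadicAlgCl 2, L = fun j ↦ ptLogΩ 2 ((integralModelInt W).map (Int.castRingHom ℤ_[2]))
      ((toLoc ((genFibΩ_eq_baseChange ((integralModelInt W).map (Int.castRingHom ℤ_[2]))).trans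
        (baseChange_twoAdicModel W))).symm (g₀ ^ j • d₀ m)) := ⟨_, rfl⟩
  have hLj : ∀ j, L j = g₀ ^ j • ptLogΩ 2 ((integralModelInt W).map (Int.castRingHom ℤ_[2]))
      ((toLoc ((genFibΩ_eq_baseChange ((integralModelInt W).map (Int.castRingHom ℤ_[2]))).trans
        (baseChange_twoAdicModel W))).symm (d₀ m)) := fun j ↦ by
    rw [hLdef]; exact ptLogΩ_toLoc_symm_pow_smul W g₀ j (d₀ m) @hk0
  have hL0 : L 0 = ptLogΩ 2 ((integralModelInt W).map (Int.castRingHom ℤ_[2]))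
      ((toLoc ((genFibΩ_eq_baseChange ((integralModelInt W).map (Int.castRingHom ℤ_[2]))).trans
        (baseChange_twoAdicModel W))).symm (d₀ m)) := by rw [hLj, pow_zero, one_smul]
  have hLorb : ∀ j, L j = g₀ ^ j • L 0 := fun j ↦ by rw [hLj j, hL0]
  have hL0mem : L 0 ∈ layer 2 (m + 2) := by
    rw [hL0]; exact ptLogΩ_mem_layer W ι hκ m (d₀ m) (hd₀L m) @hk0
  have hLneg : ∀ a : ZMod (2 ^ (m + 2)), IsUnit a → F.τ (m + 2) (-a) • L 0 = F.τ (m + 2) a • L 0 := by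
    intro a hau; rw [hL0]; exact tau_neg_smul_ptLogΩ_eq W ι hκ m (F.τ (m + 2)) (F.hτ (m + 2)) hau (d₀ m) (hd₀L m) @hk0
  have hg₀1 : g₀ • zeta 2 (m + 2) = zeta 2 (m + 2) ^ 5 := by simpa using hζpow (m + 2) 1
  -- the formal points `g₀^j d₀,m` and their transports `g^j d_m`
  have hmemv : ∀ j : ℕ, g ^ j • d m ∈ localLayerPointsOfEmb κ (closureEmb (K := ℚ) (π.v.adicCompletion ℚ)) W m :=
    fun j ↦ smul_mem_localLayerPointsOfEmb κ (closureEmb (K := ℚ) (π.v.adicCompletion ℚ)) W m (g ^ j) (hdL m)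
  have hpt : ∀ j : ℕ, (show localPoints W (π.v.adicCompletion ℚ) from
      WeierstrassCurve.Affine.Point.map (W' := W)
        (F.Φ : AlgebraicClosure ℚ_[2] →ₐ[ℚ] AlgebraicClosure (π.v.adicCompletion ℚ))
        (show (W.baseChange (AlgebraicClosure ℚ_[2])).toAffine.Point from (g₀ ^ j • d₀ m))) = g ^ j • d m := by
    intro j
    have h := hTg W j (d₀ m)
    have h' := hdT m
    dsimp only at h h' ⊢
    rw [h, h']
  have hQv : ∀ j : ℕ, WeierstrassCurve.Affine.Point.map (W' := W)
        (F.Φ : AlgebraicClosure ℚ_[2] →ₐ[ℚ] AlgebraicClosure (π.v.adicCompletion ℚ))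
        (show (W.baseChange (AlgebraicClosure ℚ_[2])).toAffine.Point from (g₀ ^ j • d₀ m)) ∈
      localLayerPointsOfEmb κ (closureEmb (K := ℚ) (π.v.adicCompletion ℚ)) W m := by
    intro j
    have h := hpt j
    dsimp only at h
    rw [h]
    exact hmemv j
  have hkj : ∀ j : ℕ, (toLoc ((genFibΩ_eq_baseChange ((integralModelInt W).map (Int.castRingHom ℤ_[2]))).trans
      (baseChange_twoAdicModel W))).symm (g₀ ^ j • d₀ m) ∈
        kernel (Valued.v (R := PadicAlgCl 2)) (genFibΩ 2 ((integralModelInt W).map (Int.castRingHom ℤ_[2]))) :=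
    fun j ↦ @toLoc_symm_smul_mem_kernel W _ (g₀ ^ j) (d₀ m) @hk0
  -- (BKρ) at these points: the pairing values `V j`
  have hV : ∀ j : ℕ, algebraMap ℚ_[2] (PadicAlgCl 2)
        ((π.pair m (I.proj m ((PowerSeries.C y : IwasawaAlgebraO S) • z)) (Pi.single i ⟨g ^ j • d m, hmemv j⟩) : ℤ_[2]) : ℚ_[2]) =
      ∑ l : Fin π.nb, algebraMap ℚ_[2] (PadicAlgCl 2) ((π.t₀ (c' i * y * π.bO l) : ℤ_[2]) : ℚ_[2]) *
        ∑ b : (ZMod (2 ^ (m + 2)))ˣ, F.τ (m + 2) (b : ZMod (2 ^ (m + 2))) • (L j * w (m + 2) l) := by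
    intro j
    have h6 := hBK y m i (g₀ ^ j • d₀ m) (hQv j) (hkj j)
    have hsub : (⟨g ^ j • d m, hmemv j⟩ : localLayerPointsOfEmb κ (closureEmb (K := ℚ) (π.v.adicCompletion ℚ)) W m) = ⟨_, hQv j⟩ :=
      Subtype.ext (hpt j).symm
    rw [hsub, h6, hLdef]
  -- per `l`: the factorisation (Kobayashi Prop. 8.25) and the log character sum (`= 3 g(ψ)`)
  have hE2 : ∑ j ∈ Finset.range (2 ^ m), ψ (5 : ZMod (2 ^ (m + 2))) ^ j * L j =
      3 * gaussSum ψ (AddChar.zmodChar (2 ^ (m + 2)) (HondaLog.zeta_pow_prime_pow_self (p := 2) (m + 2))) := by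
    rw [hLdef]
    exact LocalVar.sum_pow_mul_ptLogΩ_pow_smul_plusHondaPoint_eq W hcΩ hcstab hσσ hd₀ m hg₀1 ψ hψprim hψev
  have hfac : ∀ l : Fin π.nb, ∑ j ∈ Finset.range (2 ^ m), ψ (5 : ZMod (2 ^ (m + 2))) ^ j *
        ∑ b : (ZMod (2 ^ (m + 2)))ˣ, F.τ (m + 2) (b : ZMod (2 ^ (m + 2))) • (L j * w (m + 2) l) =
      (3 * gaussSum ψ (AddChar.zmodChar (2 ^ (m + 2)) (HondaLog.zeta_pow_prime_pow_self (p := 2) (m + 2)))) *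
        ∑ b : (ZMod (2 ^ (m + 2)))ˣ, ψ⁻¹ (b : ZMod (2 ^ (m + 2))) * F.τ (m + 2) (b : ZMod (2 ^ (m + 2))) • w (m + 2) l := by
    intro l
    have h1 : ∑ j ∈ Finset.range (2 ^ m), ψ (5 : ZMod (2 ^ (m + 2))) ^ j *
          ∑ b : (ZMod (2 ^ (m + 2)))ˣ, F.τ (m + 2) (b : ZMod (2 ^ (m + 2))) • (L j * w (m + 2) l) =
        ∑ s : ZMod (2 ^ m), ψ (5 : ZMod (2 ^ (m + 2))) ^ s.val *
          ∑ b : (ZMod (2 ^ (m + 2)))ˣ, F.τ (m + 2) (b : ZMod (2 ^ (m + 2))) • (g₀ ^ s.val • L 0 * w (m + 2) l) := by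
      rw [CoreChi.sum_range_eq_sum_zmod m (fun j ↦ ψ (5 : ZMod (2 ^ (m + 2))) ^ j *
        ∑ b : (ZMod (2 ^ (m + 2)))ˣ, F.τ (m + 2) (b : ZMod (2 ^ (m + 2))) • (L j * w (m + 2) l))]
      refine Finset.sum_congr rfl fun s _ ↦ ?_
      rw [← hLorb]
    have h2 : ∑ j ∈ Finset.range (2 ^ m), ψ (5 : ZMod (2 ^ (m + 2))) ^ j * L j =
        ∑ s : ZMod (2 ^ m), ψ (5 : ZMod (2 ^ (m + 2))) ^ s.val * g₀ ^ s.val • L 0 := by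
      rw [CoreChi.sum_range_eq_sum_zmod m (fun j ↦ ψ (5 : ZMod (2 ^ (m + 2))) ^ j * L j)]
      refine Finset.sum_congr rfl fun s _ ↦ ?_
      rw [← hLorb]
    rw [h1, ← hE2, h2]
    exact sum_pow_mul_trace_eq_mul m (F.τ (m + 2)) (F.hτ (m + 2)) (hζpow (m + 2)) hL0mem hLneg ψ hψev
  -- assemble: swap the sums over `j` and `l`
  calc ∑ j ∈ Finset.range (2 ^ m), ψ (5 : ZMod (2 ^ (m + 2))) ^ j *
          algebraMap ℚ_[2] (PadicAlgCl 2)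
            ((π.pair m (I.proj m ((PowerSeries.C y : IwasawaAlgebraO S) • z)) (Pi.single i ⟨g ^ j • d m, hmemv j⟩) : ℤ_[2]) : ℚ_[2])
        = ∑ j ∈ Finset.range (2 ^ m), ∑ l : Fin π.nb, algebraMap ℚ_[2] (PadicAlgCl 2) ((π.t₀ (c' i * y * π.bO l) : ℤ_[2]) : ℚ_[2]) *
            (ψ (5 : ZMod (2 ^ (m + 2))) ^ j *
              ∑ b : (ZMod (2 ^ (m + 2)))ˣ, F.τ (m + 2) (b : ZMod (2 ^ (m + 2))) • (L j * w (m + 2) l)) := by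
          refine Finset.sum_congr rfl fun j _ ↦ ?_
          rw [hV j, Finset.mul_sum]
          refine Finset.sum_congr rfl fun l _ ↦ ?_
          ring
    _ = ∑ l : Fin π.nb, algebraMap ℚ_[2] (PadicAlgCl 2) ((π.t₀ (c' i * y * π.bO l) : ℤ_[2]) : ℚ_[2]) *
          ∑ j ∈ Finset.range (2 ^ m), ψ (5 : ZMod (2 ^ (m + 2))) ^ j *
            ∑ b : (ZMod (2 ^ (m + 2)))ˣ, F.τ (m + 2) (b : ZMod (2 ^ (m + 2))) • (L j * w (m + 2) l) := by
          rw [Finset.sum_comm]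
          refine Finset.sum_congr rfl fun l _ ↦ ?_
          rw [Finset.mul_sum]
    _ = 3 * gaussSum ψ (AddChar.zmodChar (2 ^ (m + 2)) (HondaLog.zeta_pow_prime_pow_self (p := 2) (m + 2))) *
          ∑ l : Fin π.nb, algebraMap ℚ_[2] (PadicAlgCl 2) ((π.t₀ (c' i * y * π.bO l) : ℤ_[2]) : ℚ_[2]) *
            ∑ b : (ZMod (2 ^ (m + 2)))ˣ, ψ⁻¹ (b : ZMod (2 ^ (m + 2))) * F.τ (m + 2) (b : ZMod (2 ^ (m + 2))) • w (m + 2) l := by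
          rw [Finset.mul_sum]
          refine Finset.sum_congr rfl fun l _ ↦ ?_
          rw [hfac l]
          ring

end Dictionary

end Summit.BirchSwinnertonDyer.BirchSwinnertonDyer.Theorems.ThetaTransport.StationR

end
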